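import Literature.MathematicalPhysics.QuantumFieldTheory.Balaban1983to89.B9Eq315QFlatNorm
import Literature.MathematicalPhysics.QuantumFieldTheory.Balaban1983to89.B5Block118

/-!
# `Balaban1983to89.B9Eq315FlatDictionary` — T. Bałaban, *Propagators for lattice gauge theories in a background field*, Commun. Math. Phys. **99**
# (1985) 389–434 [Balaban1985BackgroundPropagators] (3.15)/(3.19) p. 393 at the flat background, against *Propagators and renormalization
# transformations for lattice gauge theories. I*, Commun. Math. Phys. **95** (1984) 17–40 [Balaban1984PropagatorsI] (1.18)/(1.20) p. 20: THE SITE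
# DICTIONARY BETWEEN THE pub-balaban NE9 CHAIN'S PERIODIC LATTICE `TSite d (L·m)` AND THE b05 TORUS `Tor (fine L m)`, AND UNDER IT THE FLAT
# ONE-STEP AVERAGINGS `Q(1)`, `Q′(1)` OF THE CHAIN ARE b05's MATRICES `QvOp`, `QsOp` OF (1.18)/(1.20)

statement-level skeleton of published theorems with citation tags; proofs where landed; nothing here is a claim about the Yang–Mills mass gap

PDF held: `paper:balaban1985-cmp99-background-propagators` pp. 393–395; [Balaban1984PropagatorsI] (1.18)–(1.20) p. 20 via the tree's `B5Block118` docstrings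
(read by this seat 2026-08-22).

THE PRINT (verbatim).  [B5] (1.18) (tree: `B5Block118.QvOp_mulVec`): *«(Q_kA)_b = Σ_{x∈B^k(b₋)} η^{d+1}A([x, x(b)])»*; (1.20) (`QsOp_mulVec`): *«(Q′_kλ)(y) =
Σ_{x∈B^k(y)} η^dλ(x)»*.  [B9] (3.19) p. 393: *«(Q′(V)λ)(y) = Σ_{x∈B(y)} L^{−d} R(V(Γ_{y,x}))λ(x)»* — at `V = 1` the plain block mean; (3.15): the vector
averaging `Q(U)`, at `U = 1` the mean over the `L^{d+1}` bonds of [B7] (125) (`B9Eq315QFlatNorm.QtorusLin_one_apply`).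

WHY THIS FILE (cell context).  After the NE9 leaves' volume-free letters for the owner's fixed-lattice [B9] Thm 3.11 second half
(`B9Thm311SmallFieldCoercivity`: `CS` — `B9Eq319CentreLiftL2`; `MQ` — `B9Eq315QFlatNorm`; `μ` — `B9Eq323FlatBlockPoincare`; `δ_Q` — `B9Eq383QSemiLocal`), the
ONLY constant of its `(γ, ε₀)` still obtained by compactness is the FLAT COERCIVITY `γ₀` of `B5Eq172FlatCoercivity` (`exists_coercive_of_rePosDef`).  The
uniform constant is IN THE TREE on the b05 carrier: `B5DeltaA169.smul_LapOne_le_DeltaA` (`γ(Δ + I) ≤ Δ_a`, `γ = 1/((d+1)·Cst d a)`, independent of `n`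
and of the torus — [B5] Prop. 1.1 (1.90)).  Transporting it to the chain's letters needs a dictionary chain-carrier ↔ b05-carrier at the flat
background; this file is its first, purely combinatorial layer: sites, blocks, and the two averaging operators.

WHAT IS PROVED (sorry-free; no inequality of the papers; 0 `def`).
* §1 **`torCast_bijective`**: the coordinatewise cast `x ↦ (x_i mod P_i)_i : TSite d P → Tor P` is a bijection (written as a lambda — this file
  declares NO `def`), **`torCast_perSite`** (the torus reading of `x ∈ ℤ^d` is the integer cast `(x_i : ZMod P_i)`).
* §2 **`torCast_blockPoint`**∕**`torCast_chartPoint`**: the chain's block point `(L·y + r + i e_κ) mod L·m` IS b05's `bpt L m (y mod m) r + tstep κ i`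
  (`up`/`iota`/`tstep` of `B5Block118`).
* §3 **`QvOp_mulVec_eq_QtorusLin_one`**: for a scalar bond function `A` on the b05 torus, `(QvOp L m *ᵥ A)(y mod m, κ) = (Q(1)(A ∘ cast))(y, κ)` — the chain's
  `B9Eq315QTorus.QtorusLin … (fun _ ↦ 1) …` at `𝔸 = ℂ`; **`QsOp_mulVec_eq_blockMean`**: `(QsOp L m *ᵥ f)(y mod m) = L^{−d}·Σ_r f((L·y + r) mod L·m)`
  — the plain block mean of (3.19) at `V = 1` in b05's coordinates.
* §5 `torCast_unshift`, **`GradOp_conjTranspose_mulVec_eq_covDiv_flat`** (real `c`: `(GradOp P c)ᴴ` IS the chain's flat divergence `covDiv c (fun _ ↦ id)`),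
  **`LapS_mulVec_eq_covLaplace_flat`** (`LapS P c` IS the chain's flat `D*D` on sites).
* §4 `torCast_shift` (`shift κ x ↦ cast x + unitVec κ`), **`GradOp_mulVec_eq_covDeriv_flat`**: b05's `GradOp P c` IS the chain's flat derivative
  `B9Eq33CovDerivVector.covDeriv c (fun _ ↦ id)` under the cast (scalar fields, any `c`).
MODEL / DECLARED READINGS.  (M1) one averaging step (`n = L`), scalar (`ℂ`-valued) fields — the `W`-valued chain reduces to these coordinatewise at the
flat background (Parseval; not in this file).  (M2) no hypothesis of the papers displayed; the flat regularity letters `hα1′, hU1′, hreg′` of `QtorusLin`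
are free, as in `B9Eq315QFlatNorm`.  (M3) NOT HERE: the weighted `L²` identifications, `R(1) ↔ 1 − PcT`, the weights, the transfer of (1.90) itself.
HONEST SCOPE.  [folklore] index bookkeeping between two typed carriers of the same printed lattice; nothing of [B5] (1.89)–(1.90) or [B9] Thm 3.11 is
asserted or transported here; NOT summit progress (cell pub-balaban: NE9 NOT PRINTED / NOT PROVED; «NE9 ⇐ the named binders»; spine PROVED 0/9; HONEST
DEPENDENCY: continuum YM on T⁴ ⇐ BetaPertH ∧ nine spine estimates (0/9 proved); BetaPertH ⇐ (D1) ∧ (D4) ∧ CAP+tail; G-an2-4 gates asym, D1 and NE2/3/4).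
Unit `b2b-balaban-t4-ne9-formalise-leaf-03` (NE9 crux-team leaf prover, gen 58), OFFER O-ne9leaf03-g58-1 item (B1); NEW file importing `B9Eq315QFlatNorm` +
`B5Block118` (first NE9-row import of the b05 `B5Block118` cone); modifies nothing.  Net new unproved facts: 0.
-/

noncomputable section

open scoped BigOperators

namespace Literature.MathematicalPhysics.QuantumFieldTheory.Balaban1983to89.B9Eq315FlatDictionary

open B4Sect5Torus (TSite)
open B9SectCLatticeCarrier (Bond)
open B7Prop1Explicit (U1 Wcx boxVec e)
open B9Eq319QprimeTorus (fineP)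
open B9Eq315QTorus (perSite perCfg cornerSite QtorusLin)
open B9Eq315QFlatNorm (QtorusLin_one_apply cornerSite_add_boxVec_apply)
open B5Prop11Plancherel (Tor fine)
open B5Block118 (up iota bpt tstep QsOp QvOp lineSum QsOp_mulVec QvOp_mulVec upHom_intCast)

variable {d : ℕ}

/-! ## §1 The site dictionary `TSite d P ≃ Tor P` -/

section Sites

variable (P : Fin d → ℕ) [∀ i, NeZero (P i)]

/-- **THE SITE DICTIONARY IS A BIJECTION**: the coordinatewise cast `x ↦ (x_i mod P_i)_i` from the chain's periodic lattice `TSite d P = Π_i Fin (P i)`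
onto b05's torus `Tor P = Π_i ZMod (P i)` (no `def`: the map is written as the lambda `fun x i => ((x i : ℕ) : ZMod (P i))` throughout).
[folklore] [cite: Balaban1984PropagatorsI, (1.18) p.20; Balaban1985BackgroundPropagators, (3.1) p.390] -/
theorem torCast_bijective : Function.Bijective (fun x : TSite d P => fun i => ((x i : ℕ) : ZMod (P i))) := by
  refine ⟨fun x x' h => funext fun i => Fin.ext ?_, fun z => ⟨fun i => ⟨(z i).val, ZMod.val_lt (z i)⟩, funext fun i => ?_⟩⟩
  · have hi := congr_fun h i
    have hv := congr_arg ZMod.val hi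
    simp only [ZMod.val_natCast, Nat.mod_eq_of_lt (x i).isLt, Nat.mod_eq_of_lt (x' i).isLt] at hv
    exact hv
  · simp only [ZMod.natCast_val, ZMod.cast_id', id_eq]

/-- **THE TORUS READING OF `ℤ^d` IS THE INTEGER CAST**: `(perSite P x)_i mod P_i = (x_i : ZMod P_i)` (`perSite` reduces `mod P_i`, the cast does the
same). [folklore] [cite: Balaban1985Averaging, (1) p.17; Balaban1984PropagatorsI, (1.18) p.20] -/
theorem torCast_perSite (x : B7Prop1Explicit.Site d) (i : Fin d) : ((perSite P x i : ℕ) : ZMod (P i)) = ((x i : ℤ) : ZMod (P i)) := by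
  have hP : (0 : ℤ) ≤ x i % (P i : ℕ) := Int.emod_nonneg _ (by exact_mod_cast NeZero.ne (P i))
  have h1 : (((perSite P x i : ℕ) : ℤ)) = x i % (P i : ℕ) := by
    show ((((x i) % (P i : ℤ)).toNat : ℕ) : ℤ) = x i % (P i : ℕ)
    exact Int.toNat_of_nonneg hP
  have h2 : ((perSite P x i : ℕ) : ZMod (P i)) = (((perSite P x i : ℕ) : ℤ) : ZMod (P i)) := by rw [Int.cast_natCast]
  rw [h2, h1, ZMod.intCast_mod]

end Sites

/-! ## §2 Blocks: the chain's `(L·y + r + ie_κ) mod L·m` is b05's `bpt y r + tstep κ i` -/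

section Blocks

variable (L : ℕ) (m : Fin d → ℕ) [∀ i, NeZero (m i)] [∀ i, NeZero (fineP L m i)]

omit [∀ i, NeZero (m i)] in
/-- **THE BLOCK POINTS AGREE**: `(L·y + r) mod L·m = bpt L m (y mod m) r` — `up y = L·y`, `iota r = r` in `ZMod (L·m_ν)` ([B5] (1.6)/(1.18):
`x = n·y + j`). [folklore] [cite: Balaban1984PropagatorsI, (1.6) p.18, (1.18) p.20; Balaban1985Averaging, (2) p.17] -/
theorem torCast_blockPoint (y : TSite d m) (r : Fin d → Fin L) :
    (fun ν => ((perSite (fineP L m) (cornerSite L y + boxVec L r) ν : ℕ) : ZMod (fineP L m ν))) =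
      bpt L m (fun i => ((y i : ℕ) : ZMod (m i))) r := by
  funext ν
  rw [torCast_perSite, cornerSite_add_boxVec_apply]
  simp only [Pi.add_apply, bpt, up, iota]
  rw [show ((y ν : ℕ) : ZMod (m ν)) = (((y ν : ℕ) : ℤ) : ZMod (m ν)) by rw [Int.cast_natCast], upHom_intCast]
  push_cast
  ring

omit [∀ i, NeZero (m i)] in
/-- … and with a shift along `e_κ`: `(L·y + r + i e_κ) mod L·m = bpt L m (y mod m) r + tstep κ i` (`tstep κ i = i e_κ`).
[folklore] [cite: Balaban1984PropagatorsI, (1.18) p.20; Balaban1985Averaging, (125) p.36] -/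
theorem torCast_chartPoint (y : TSite d m) (r : Fin d → Fin L) (κ : Fin d) (i : ℕ) :
    (fun ν => ((perSite (fineP L m) (cornerSite L y + boxVec L r + (i : ℤ) • e κ) ν : ℕ) : ZMod (fineP L m ν))) =
      bpt L m (fun i => ((y i : ℕ) : ZMod (m i))) r + tstep (fine L m) κ i := by
  funext ν
  rw [torCast_perSite, Pi.add_apply, cornerSite_add_boxVec_apply]
  simp only [Pi.add_apply, bpt, up, iota, tstep, e, Pi.smul_apply, Pi.single_apply, smul_eq_mul]
  rw [show ((y ν : ℕ) : ZMod (m ν)) = (((y ν : ℕ) : ℤ) : ZMod (m ν)) by rw [Int.cast_natCast], upHom_intCast]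
  by_cases h : ν = κ
  · subst h
    simp only [if_true, mul_one]
    push_cast
    ring
  · simp only [if_neg h, mul_zero, add_zero]
    push_cast
    ring

end Blocks

/-! ## §3 The flat averagings under the dictionary: `Q(1) ↔ QvOp`, `Q′(1) ↔ QsOp` -/

section Averaging

variable (L : ℕ) [NeZero L] (m : Fin d → ℕ) [∀ i, NeZero (m i)] [∀ i, NeZero (fineP L m i)] (hL : 1 ≤ L)
  {α' : ℝ} (hα1' : α' ≤ 1 / 64)
  (hU1' : ∀ (x : B7Prop1Explicit.Site d) (κ : Fin d), perCfg (fineP L m) (fun _ : Bond d (fineP L m) => (1 : ℂˣ)) x κ ∈ U1 ℂ)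
  (hreg' : ∀ (y : TSite d m) (κ : Fin d) (r : Fin d → Fin L),
    ‖((Wcx L (perCfg (fineP L m) (fun _ : Bond d (fineP L m) => (1 : ℂˣ))) (cornerSite L y) κ (boxVec L r) : ℂˣ) : ℂ) - 1‖ ≤ α')

/-- **`Q(1)` OF THE CHAIN IS b05's `QvOp` (1.18)**: for a scalar bond function `A` on the b05 torus,
`(QvOp L m *ᵥ A)(y mod m, κ) = (Q(1)(A ∘ cast))(y, κ)` — both are the mean of `A` over the `L^{d+1}` bonds `⟨L·y + r + ie_κ, · + e_κ⟩`
(`QvOp_mulVec` vs `B9Eq315QFlatNorm.QtorusLin_one_apply`, matched by §2). [cite: Balaban1984PropagatorsI, (1.18) p.20; Balaban1985BackgroundPropagators, (3.15) p.393; Balaban1985Averaging, (125) p.36] -/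
theorem QvOp_mulVec_eq_QtorusLin_one (A : Tor (fine L m) × Fin d → ℂ) (y : TSite d m) (κ : Fin d) :
    (QvOp L m).mulVec A (fun i => ((y i : ℕ) : ZMod (m i)), κ) =
      QtorusLin L m hL (fun _ => 1) hα1' hU1' hreg' (fun b => A (fun i => ((b.1 i : ℕ) : ZMod (fineP L m i)), b.2)) (y, κ) := by
  rw [QvOp_mulVec, QtorusLin_one_apply L m hL hα1' hU1' hreg', Complex.real_smul]
  congr 1
  · push_cast
    rw [one_div]
  · refine Finset.sum_congr rfl fun r _ => ?_
    rw [lineSum, Finset.sum_range]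
    refine Finset.sum_congr rfl fun t _ => ?_
    dsimp only
    rw [← torCast_chartPoint]

/-- **`Q′(1)` OF THE CHAIN IS b05's `QsOp` (1.20)**: `(QsOp L m *ᵥ f)(y mod m) = L^{−d}·Σ_{r} f((L·y + r) mod L·m)` — the plain block mean of
(3.19) at `V = 1` in the dictionary's coordinates (`QsOp_mulVec` + §2 at `i = 0`). [cite: Balaban1984PropagatorsI, (1.20) p.20; Balaban1985BackgroundPropagators, (3.19) p.393] -/
theorem QsOp_mulVec_eq_blockMean (f : Tor (fine L m) → ℂ) (y : TSite d m) :
    (QsOp L m).mulVec f (fun i => ((y i : ℕ) : ZMod (m i))) =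
      (1 / (L : ℂ) ^ d) * ∑ r : Fin d → Fin L, f (fun ν => ((perSite (fineP L m) (cornerSite L y + boxVec L r) ν : ℕ) : ZMod (fineP L m ν))) := by
  rw [QsOp_mulVec]
  congr 1
  exact Finset.sum_congr rfl fun r _ => by rw [torCast_blockPoint]

end Averaging

/-! ## §4 Steps and the flat derivative under the dictionary: `shift ↔ + unitVec`, `D(1) ↔ GradOp` -/

section Steps

variable (P : Fin d → ℕ) [∀ i, NeZero (P i)]

omit [∀ i, NeZero (P i)] in
/-- **THE UNIT STEP AGREES**: the chain's `shift κ x` (`x + e_κ mod P`) is b05's `(x mod P) + unitVec κ`. [folklore]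
[cite: Balaban1984PropagatorsI, (1.21) p.21; Balaban1985BackgroundPropagators, (3.3) p.390] -/
theorem torCast_shift (κ : Fin d) (x : TSite d P) :
    (fun ν => ((B9SectCLatticeCarrier.shift κ x ν : ℕ) : ZMod (P ν))) = (fun ν => ((x ν : ℕ) : ZMod (P ν))) + B5Prop11Plancherel.unitVec P κ := by
  funext ν
  rw [Pi.add_apply, B5Prop11Plancherel.unitVec]
  by_cases h : ν = κ
  · subst h
    rw [Pi.single_eq_same, B9SectCLatticeCarrier.shift_apply_val, ZMod.natCast_mod, Nat.cast_add, Nat.cast_one]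
  · rw [Pi.single_eq_of_ne h, B9SectCLatticeCarrier.shift_apply_ne h, add_zero]

/-- **THE FLAT DERIVATIVE OF THE CHAIN IS b05's `GradOp`**: for a scalar site function `f` on the b05 torus and any scalar `c`,
`(GradOp P c *ᵥ f)(x mod P, κ) = (D_c(1)(f ∘ cast))(x, κ)` — the chain's `B9Eq33CovDerivVector.covDeriv c (fun _ ↦ id)` ((3.3) at `U = 1`:
`c·(f(x + e_κ) − f(x))`). [cite: Balaban1985BackgroundPropagators, (3.3) pp.390–391; Balaban1984PropagatorsI, (1.21) p.21, (1.31) p.23] -/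
theorem GradOp_mulVec_eq_covDeriv_flat (c : ℂ) (f : Tor P → ℂ) (x : TSite d P) (κ : Fin d) :
    (B5Action121.GradOp P c).mulVec f (fun i => ((x i : ℕ) : ZMod (P i)), κ) =
      B9Eq33CovDerivVector.covDeriv c (fun _ : Bond d P => (LinearMap.id : ℂ →ₗ[ℂ] ℂ)) (fun z => f (fun i => ((z i : ℕ) : ZMod (P i)))) (x, κ) := by
  rw [B5Action121.GradOp_mulVec, B5Action121.sdiff_mulVec, B9Eq33CovDerivVector.covDeriv_apply_dir, LinearMap.id_apply, smul_eq_mul,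
    torCast_shift]

end Steps

/-! ## §5 The backward step, the flat divergence and the flat Laplace operator: `unshift ↔ − unitVec`, `D*(1) ↔ GradOpᴴ`, `Δ(1) ↔ LapS` -/

section Laplace

variable (P : Fin d → ℕ) [∀ i, NeZero (P i)]

/-- **THE BACKWARD STEP AGREES**: `unshift κ x` (`x − e_κ mod P`) is `(x mod P) − unitVec κ`. [folklore] [cite: Balaban1985BackgroundPropagators, (3.8) p.392] -/
theorem torCast_unshift (κ : Fin d) (x : TSite d P) :
    (fun ν => ((B9SectCLatticeCarrier.unshift κ x ν : ℕ) : ZMod (P ν))) = (fun ν => ((x ν : ℕ) : ZMod (P ν))) - B5Prop11Plancherel.unitVec P κ := by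
  funext ν
  rw [Pi.sub_apply, B5Prop11Plancherel.unitVec]
  by_cases h : ν = κ
  · subst h
    have hP : 1 ≤ P ν := Nat.one_le_iff_ne_zero.2 (NeZero.ne (P ν))
    rw [Pi.single_eq_same, B9SectCLatticeCarrier.unshift_apply_val, ZMod.natCast_mod, Nat.cast_add, eq_sub_iff_add_eq, add_assoc,
      ← Nat.cast_add_one, Nat.sub_add_cancel hP, ZMod.natCast_self, add_zero]
  · rw [Pi.single_eq_of_ne h, B9SectCLatticeCarrier.unshift_apply_ne h, sub_zero]

/-- **THE FLAT DIVERGENCE OF THE CHAIN IS b05's `GradOpᴴ`** (for a REAL scalar `c`, where the conjugate-transpose and (3.8) agree):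
`((GradOp P c)ᴴ *ᵥ A)(x mod P) = (D*_c(1)(A ∘ cast))(x)` — `B9Eq33CovDerivVector.covDiv c (fun _ ↦ id)` = `c·Σ_μ (A(x − e_μ, μ) − A(x, μ))` vs
`B5Action121.divS_apply` = `Σ_μ c̄·(…)`. [cite: Balaban1985BackgroundPropagators, (3.8) p.392; Balaban1984PropagatorsI, (1.21) p.21] -/
theorem GradOp_conjTranspose_mulVec_eq_covDiv_flat (c : ℂ) (hc : (starRingEnd ℂ) c = c) (A : Tor P × Fin d → ℂ) (x : TSite d P) :
    (B5Action121.GradOp P c).conjTranspose.mulVec A (fun i => ((x i : ℕ) : ZMod (P i))) =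
      B9Eq33CovDerivVector.covDiv c (fun _ : Bond d P => (LinearMap.id : ℂ →ₗ[ℂ] ℂ)) (fun b => A (fun i => ((b.1 i : ℕ) : ZMod (P i)), b.2)) x := by
  rw [B5Action121.GradOp_conjTranspose_mulVec, B5Action121.divS_apply, B9Eq33CovDerivVector.covDiv_apply, smul_eq_mul, Finset.mul_sum]
  refine Finset.sum_congr rfl fun μ _ => ?_
  rw [hc, LinearMap.id_apply]
  dsimp only
  rw [torCast_unshift, sub_eq_add_neg]

/-- **THE FLAT LAPLACE OPERATOR OF THE CHAIN IS b05's `LapS`** (real `c`): `(LapS P c *ᵥ f)(x mod P) = (D*_c(1) D_c(1) (f ∘ cast))(x)` —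
`GradOpᴴ GradOp = LapS` (`B5Action121.GradOp_conjTranspose_mul_GradOp`) read through §4–§5. [cite: Balaban1985BackgroundPropagators, (3.23) p.394; Balaban1984PropagatorsI, (1.21) p.21] -/
theorem LapS_mulVec_eq_covLaplace_flat (c : ℂ) (hc : (starRingEnd ℂ) c = c) (f : Tor P → ℂ) (x : TSite d P) :
    (B5Action121.LapS P c).mulVec f (fun i => ((x i : ℕ) : ZMod (P i))) =
      B9Eq33CovDerivVector.covDiv c (fun _ : Bond d P => (LinearMap.id : ℂ →ₗ[ℂ] ℂ))
        (B9Eq33CovDerivVector.covDeriv c (fun _ : Bond d P => (LinearMap.id : ℂ →ₗ[ℂ] ℂ)) (fun z => f (fun i => ((z i : ℕ) : ZMod (P i))))) x := by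
  rw [← B5Action121.GradOp_conjTranspose_mul_GradOp, ← Matrix.mulVec_mulVec, GradOp_conjTranspose_mulVec_eq_covDiv_flat P c hc]
  have h : (fun b : Bond d P => (B5Action121.GradOp P c).mulVec f (fun i => ((b.1 i : ℕ) : ZMod (P i)), b.2)) =
      B9Eq33CovDerivVector.covDeriv c (fun _ : Bond d P => (LinearMap.id : ℂ →ₗ[ℂ] ℂ)) (fun z => f (fun i => ((z i : ℕ) : ZMod (P i)))) :=
    funext fun b => GradOp_mulVec_eq_covDeriv_flat P c f b.1 b.2
  rw [h]

end Laplace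

end Literature.MathematicalPhysics.QuantumFieldTheory.Balaban1983to89.B9Eq315FlatDictionary

end
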